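import Summits.ResolutionOfSingularities.ResolutionOfSingularities.Theorems.WeightedInvariantKeyRungThreeOfDropPointIso
import HarnessLib

/-!
# (D-b³-point-STAT), point regimes with `ε ≠ 1` (ISOLATED and TIE): NO order-stationary prime `t⁻¹ ∈ 𝔮` strictly below a `t`-homogeneous
# successor, for EVERY presentation `(u, w)` of `J₃ᵗ` (door `HypersurfaceCentreConstruction`, stmt-ResolutionOfSingularities-19897, stub
# `stub_keyRungGrHomLE_three`)

Topic: `Summits/ResolutionOfSingularities/ResolutionOfSingularities/Theorems`.  DEF-FREE.  Helper `--supports stmt-ResolutionOfSingularities-19897`.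

Sequel of …KeyRungThreeOfDropPointIso.  The exceptional half of (iso-succ) PART C (`Iota3.iotaOrd_lt_below_of_isSigmaMaximiser`,
…IsoSuccNoStatCurve) uses only that the centre `J₃ᵗ` is the σ-maximiser filtration — true at every dimension-3 point position with `ε ≠ 1`
(`jFlatT_eq_jSigmaPt`), i.e. in the ISOLATED regime `(ε, τ) = (0, 0)` AND in the TIE regime `(0, 1)`.  This file records that half for EVERY
presentation `(u, w)` of `J₃ᵗ`, without the isolation hypothesis:

* `Iota3.iotaOrd_lt_below_of_isSigmaMaximiser_of_eq` — PART C with the filtration carrier-transported (`I = 𝒥((x,g₂,g₁);(q,r₂,r₁))`, `t`-homogeneity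
  spelled on `extReesAlgebra I`).
* **`Iota3.pointStat_below_exceptional`** — in the binders of (D-b³-point-STAT) (`P = 𝔪`) with `iotaEps S f ≠ 1`: for every presentation `(u, w)` of
  `J₃ᵗ`, every `t`-homogeneous off-vertex successor `𝔫 ∋ t⁻¹`, every saturated transform `g` and every prime `t⁻¹ ∈ 𝔮 < 𝔫`: `ord_{B_𝔮}(g/1) < ν`
  (`ν = ord_S f`).  So also at TIE starts the curves of the weighted exceptional plane are never order-stationary; what CAN be order-stationary
  below a successor of a tie start are the primes off `V(t⁻¹)` over the equimultiple curve `V(P₀)` (by design of the tie regime).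

[OURS · L1 W4.3 · audit glue; AI work, weaker than expert review; nothing here is a statement of the manuscript under review (Hironaka 2017,
[claim: Hironaka2017, status: under-review]).]

## References

* J. Włodarczyk, *Functorial resolution by torus actions*, arXiv:2203.03090, §3.3. [Wlodarczyk2022]
-/

noncomputable section

set_option linter.dupNamespace false -- mandated namespace of this single-conjunct summit

open IsLocalRing Literature.AlgebraicGeometry.Resolution
open Summit.ResolutionOfSingularities.ResolutionOfSingularities.Theorems
open Summit.ResolutionOfSingularities.ResolutionOfSingularities.Theorems.ContactCylinder

namespace Summit.ResolutionOfSingularities.ResolutionOfSingularities.Cruxes.HypersurfaceCentreConstruction.LocalEngine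

namespace Iota3

/-- PART C (`iotaOrd_lt_below_of_isSigmaMaximiser`) with the filtration carrier-transported. [OURS · L1 W4.3 · seam] -/
theorem iotaOrd_lt_below_of_isSigmaMaximiser_of_eq {S : Type} [CommRing S] [IsRegularLocalRing S] (hdim : ringKrullDim S = 3)
    {f x g₁ g₂ : S} {ν q r₁ r₂ : ℕ} (hν : 0 < ν) (hmax : IsSigmaMaximiser f ν g₁ g₂ q r₁ r₂)
    (hfν1 : f ∉ maximalIdeal S ^ (ν + 1)) (hx : Ideal.span {x, g₂, g₁} = maximalIdeal S)
    {I : ℕ → Ideal S} (hI : I = weightedMonomialIdeal ![x, g₂, g₁] ![q, r₂, r₁]) :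
    ∀ (𝔮 : Ideal (extReesAlgebra I)) [𝔮.IsPrime], extReesAlgebra.tInv I ∈ 𝔮 →
      ∀ (𝔫₁ : Ideal (extReesAlgebra I)) [𝔫₁.IsPrime], 𝔮 < 𝔫₁ →
      Ideal.span {b | b ∈ 𝔫₁ ∧ SetLike.IsHomogeneousElem (KWildHom.tPiece (extReesAlgebra I)) b} = 𝔫₁ →
      ¬ (extReesAlgebra.vertexIdeal I ≤ 𝔫₁) →
      ∀ (a' : ℕ) (g : extReesAlgebra I), algebraMap S (extReesAlgebra I) f = extReesAlgebra.tInv I ^ a' * g →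
        ¬ (extReesAlgebra.tInv I ∣ g) →
        iotaOrd (Localization.AtPrime 𝔮) (algebraMap (extReesAlgebra I) (Localization.AtPrime 𝔮) g) < ν := by
  subst hI
  intro 𝔮 _ hT 𝔫₁ _ hlt hhom hV a' g hfg hndvd
  exact iotaOrd_lt_below_of_isSigmaMaximiser hdim hν hmax hfν1 hx 𝔮 hT 𝔫₁ hlt hhom hV a' g hfg hndvd

/-- **(D-b³-point-STAT), regimes `ε ≠ 1`: no order-stationary prime `t⁻¹ ∈ 𝔮` strictly below a `t`-homogeneous successor, for every presentation
of `J₃ᵗ`.** [OURS · L1 W4.3 · (iso-succ) PART C for the door, ISOLATED and TIE regimes] -/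
theorem pointStat_below_exceptional (p : ℕ) (k₀ : Type) [Field k₀] [CharP k₀ p] [PerfectField k₀]
    (S : Type) [CommRing S] [Algebra k₀ S] [Algebra.EssFiniteType k₀ S] [IsRegularLocalRing S]
    (f : S) (hd : ringKrullDim S = 3) (hf0 : f ≠ 0) (hf2 : f ∈ (maximalIdeal S) ^ 2)
    (P : Ideal S) [P.IsPrime] (hE : topStratum iotaOrdEpsTau S f = {𝔮 | P ≤ 𝔮.asIdeal}) (hPm : P = maximalIdeal S)
    (hε : iotaEps S f ≠ 1)
    (n : ℕ) (u : Fin n → S) (w : Fin n → ℕ) (h5 : ∀ m : ℕ, weightedMonomialIdeal u w m = jFlatT S f m)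
    (𝔫 : Ideal (cobordantAlgebra' u w)) [𝔫.IsPrime] (hhom : IsTHomogeneous u w 𝔫)
    (hV : ¬ extReesAlgebra.vertexIdeal (weightedMonomialIdeal u w) ≤ 𝔫)
    (a : ℕ) (g : cobordantAlgebra' u w) (hfg : algebraMap S (cobordantAlgebra' u w) f = cobordantT' u w ^ a * g)
    (hTg : ¬ cobordantT' u w ∣ g)
    (ν : ℕ) (hfν : f ∈ maximalIdeal S ^ ν) (hfν1 : f ∉ maximalIdeal S ^ (ν + 1)) :
    ∀ (𝔮 : Ideal (cobordantAlgebra' u w)) [𝔮.IsPrime], cobordantT' u w ∈ 𝔮 → 𝔮 < 𝔫 →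
      iotaOrd (Localization.AtPrime 𝔮) (algebraMap (cobordantAlgebra' u w) (Localization.AtPrime 𝔮) g) < ν := by
  subst hPm
  have hν : 0 < ν := by
    by_contra hν0
    have hν0' : ν = 0 := by omega
    subst hν0'
    exact hfν1 (by rw [zero_add, pow_one]; exact Ideal.pow_le_self two_ne_zero hf2)
  have hfu : ¬ IsUnit f := (IsLocalRing.mem_maximalIdeal _).mp (Ideal.pow_le_self two_ne_zero hf2)
  have htop : topStratumPrime iotaOrdEpsTau S f = maximalIdeal S := topStratumPrime_eq_maximalIdeal_of_topStratum_eq _ S f hE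
  have hdim' : ringKrullDim S = (3 : ℕ) := by rw [hd]; norm_cast
  have hd2 : ¬ ringKrullDim S ≤ 2 := by rw [hd]; decide
  have hadic : (adicOrder f).toNat = ν := adicOrder_toNat_eq_of_mem_of_not_mem hfν hfν1
  obtain ⟨g₁, g₂, q, r₁, r₂, hmax, hprim⟩ :=
    sigmaMaximiserExistsLE3_of_atLevel p (twoFlagDominanceAtLevelLE3Body_holds p) k₀ S f hdim' hf0 hf2 htop hε
  obtain ⟨x, h𝔪, -⟩ := exists_span_triple_of_isTwoFlag S hdim' g₁ g₂ hmax.2.1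
  have hcan := jSigmaCanonicalLE3_of_atLevel p (twoFlagDominanceAtLevelLE3Body_holds p) k₀ S f hdim' hf0 hf2 htop hε
  have hJ : ∀ m, jFlatT S f m = weightedMonomialIdeal ![x, g₂, g₁] ![q, r₂, r₁] m := fun m =>
    jFlatT_eq_weightedMonomialIdeal_of_canonicalAt hf0 hfu htop hd2 hε hcan hmax hprim h𝔪 m
  have hI : weightedMonomialIdeal u w = weightedMonomialIdeal ![x, g₂, g₁] ![q, r₂, r₁] := funext fun m => (h5 m).trans (hJ m)
  rw [hadic] at hmax
  intro 𝔮 _ hT𝔮 hlt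
  exact iotaOrd_lt_below_of_isSigmaMaximiser_of_eq hd hν hmax hfν1 h𝔪 hI 𝔮 hT𝔮 𝔫 hlt hhom hV a g hfg hTg

end Iota3

end Summit.ResolutionOfSingularities.ResolutionOfSingularities.Cruxes.HypersurfaceCentreConstruction.LocalEngine

end
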